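import Summits.ValiantsHypothesis.ValiantsHypothesis.Theorems.GrenetZeonDualUnipotentThreeHalvesHeavyTopBorderOrthogonality

/-!
# `GrenetZeon.DualUnipotentThreeHalves` (stmt-ValiantsHypothesis-24318) — P-Q1 kernel port (lead-g2 `P-Q1-LEVEL2-PORTMAP.md` L2.2):
# THE `z¹`-COEFFICIENT OF `tr(M (A + zE)^m)`: `Σ_{i<m} tr(M A^i E A^{m−1−i}) = 0`, AND THE VANISHING SIDE OF (E1)

Experiment cell «val-heavytop-census» (D-0160), engine seat val-htc-eng-1 (g3), kit 0; director R340 (3) (P-Q1 port, eng lineage).  Size-free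
(any finite index type), on top of eng-2 g3's ✓ `…HeavyTopPencilFirstOrder` (`coeff_one_C_add_C_mul_X_pow`) and ✓ `…HeavyTopBorderOrthogonality`
(`trace_map_eval`, `trace_firstOrder_eq_zero`).

* ★ `trace_mul_firstOrder_eq_zero` — `(∀ z, tr(M (A + zE)^m) = 0) ⇒ tr(M · Σ_{i<m} A^i E A^{m−1−i}) = 0` (the polynomial `tr((M.map C)·Q^m)`,
  `Q = matPolyEquiv⁻¹(C A + C E·X)`, has infinitely many roots; its `X¹`-coefficient is `tr(M · [P^m]_1)`); `sum_trace_mul_sandwich_eq_zero` —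
  expanded form `Σ_{i<m} tr(M A^i E A^{m−1−i}) = 0` (port map L2.2 `coeff_one_trace_mul_pow`).
* ★ `sum_trace_mul_sandwich_eq_zero_of_mem` — in a linear space `V` all of whose members have trace-free powers (e.g. a nilpotent space), for
  `X, A, E ∈ V` and `k ≥ 2`: `Σ_{a<k−1} tr(X A^a E A^{k−2−a}) = 0` — exactly the VANISHING of the left side of (E1)_{j,k} in Q1-PROOF §2 / port map
  (B) («`B := yA + zÊ ∈ V`, so `tr(ŵ_j B^{k−1}) = 0` for all `y, z`; put `y = 1` and take the `z¹`-coefficient»); the EVALUATION of that side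
  (`= τ_j (k−1) 0 + g_{j+k−2}`) is L2.3, by ✓ `…HeavyTopShiftSandwich`.

Pure matrix algebra; ι(7), (5,7), R2, 24318 OPEN / not moved; VP ≠ VNP NOT proved.  `--supports stmt-ValiantsHypothesis-24318 --as helper`.
No definitions, no named facts. [lead-g2 `P-Q1-LEVEL2-PORTMAP.md` (B), (C) L2.2; this seat]
-/

set_option linter.dupNamespace false
set_option autoImplicit false

namespace Summit.ValiantsHypothesis.ValiantsHypothesis.Theorems.GrenetZeon.HeavyTopTraceFirstOrder

open Matrix Polynomial
open scoped BigOperators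
open Summit.ValiantsHypothesis.ValiantsHypothesis.Theorems.GrenetZeon.HeavyTopPencilFirstOrder (coeff_one_C_add_C_mul_X_pow)
open Summit.ValiantsHypothesis.ValiantsHypothesis.Theorems.GrenetZeon.HeavyTopBorderOrthogonality (trace_map_eval)

/-- ★ **First order of a weighted trace** (port map L2.2 `coeff_one_trace_mul_pow`).  If `tr(M · (A + zE)^m) = 0` for every `z : ℂ`, then
`tr(M · Σ_{i<m} A^i E A^{m−1−i}) = 0` — the `z¹`-coefficient of the polynomial `z ↦ tr(M (A + zE)^m)`.  (Q1-PROOF §2 / port map (B): from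
`tr(ŵ_j (A + zÊ)^{k−1}) = 0` for all `z` to `Σ_{a+b=k−2} tr(ŵ_j A^a Ê A^b) = 0`, the left side of (E1).) [folklore; this file] -/
theorem trace_mul_firstOrder_eq_zero {n : Type*} [Fintype n] [DecidableEq n] (M A E : Matrix n n ℂ) (m : ℕ)
    (h : ∀ z : ℂ, Matrix.trace (M * (A + z • E) ^ m) = 0) :
    Matrix.trace (M * ∑ i ∈ Finset.range m, A ^ i * E * A ^ (m - 1 - i)) = 0 := by
  classical
  set P : (Matrix n n ℂ)[X] := C A + C E * X with hP
  set Q : Matrix n n ℂ[X] := matPolyEquiv.symm P with hQ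
  have hQx : ∀ z : ℂ, Q.map (Polynomial.eval z) = A + z • E := by
    intro z
    rw [hQ, matPolyEquiv_symm_map_eval, hP, Polynomial.eval_add, Polynomial.eval_C, Polynomial.eval_mul_X,
      Polynomial.eval_C]
    ext i j
    simp [Matrix.scalar_apply, Matrix.mul_diagonal, mul_comm]
  -- the polynomial `tr(M Q^m)` vanishes at every `z`, hence is zero
  set F : Matrix n n ℂ[X] := M.map Polynomial.C * Q ^ m with hF
  have hFz : ∀ z : ℂ, F.map (Polynomial.eval z) = M * (A + z • E) ^ m := by
    intro z
    have e1 : F.map (Polynomial.eval z) = (M.map Polynomial.C).map (Polynomial.eval z) * (Q ^ m).map (Polynomial.eval z) := by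
      change (Polynomial.evalRingHom z).mapMatrix (M.map Polynomial.C * Q ^ m) = _
      rw [map_mul]
      rfl
    have e2 : (Q ^ m).map (Polynomial.eval z) = (Q.map (Polynomial.eval z)) ^ m := by
      change (Polynomial.evalRingHom z).mapMatrix (Q ^ m) = ((Polynomial.evalRingHom z).mapMatrix Q) ^ m
      exact map_pow _ _ _
    have e3 : (M.map Polynomial.C).map (Polynomial.eval z) = M := by
      rw [Matrix.map_map]
      ext i j
      simp
    rw [e1, e2, e3, hQx]
  have htr : Matrix.trace F = 0 := by
    apply Polynomial.eq_zero_of_infinite_isRoot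
    refine Set.infinite_univ.mono fun z _ => ?_
    rw [Set.mem_setOf_eq, Polynomial.IsRoot, ← trace_map_eval, hFz, h z]
  -- its `X¹`-coefficient is `tr(M · [P^m]_1)`
  have hc : (Matrix.trace F).coeff 1 = Matrix.trace (M * (matPolyEquiv (Q ^ m)).coeff 1) := by
    simp only [hF, Matrix.trace, Matrix.diag_apply, Matrix.mul_apply, Polynomial.finsetSum_coeff, Matrix.map_apply,
      Polynomial.coeff_C_mul, matPolyEquiv_coeff_apply]
  rw [htr, Polynomial.coeff_zero, map_pow, hQ, AlgEquiv.apply_symm_apply, hP, coeff_one_C_add_C_mul_X_pow] at hc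
  exact hc.symm

/-- The same, expanded: `Σ_{i<m} tr(M A^i E A^{m−1−i}) = 0`. [this file] -/
theorem sum_trace_mul_sandwich_eq_zero {n : Type*} [Fintype n] [DecidableEq n] (M A E : Matrix n n ℂ) (m : ℕ)
    (h : ∀ z : ℂ, Matrix.trace (M * (A + z • E) ^ m) = 0) :
    ∑ i ∈ Finset.range m, Matrix.trace (M * (A ^ i * E * A ^ (m - 1 - i))) = 0 := by
  have h1 := trace_mul_firstOrder_eq_zero M A E m h
  rwa [Finset.mul_sum, Matrix.trace_sum] at h1

/-- **(E1)'s left-hand side vanishes** (port map (B), derivation): if every member of the linear space `V` has trace-free powers — in particular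
if `V` consists of nilpotent matrices — and `X, A, E ∈ V`, then `Σ_{a<k−1} tr(X A^a E A^{k−2−a}) = 0` for every `k ≥ 2`: apply
✓ `trace_firstOrder_eq_zero` (`tr(X B^{k−1}) = 0` for `B = A + zE ∈ V`, all `z`) and then the `z¹`-coefficient. [this file] -/
theorem sum_trace_mul_sandwich_eq_zero_of_mem {n : Type*} [Fintype n] [DecidableEq n] (V : Submodule ℂ (Matrix n n ℂ))
    (hV : ∀ B ∈ V, ∀ k : ℕ, 1 ≤ k → Matrix.trace (B ^ k) = 0) {X A E : Matrix n n ℂ} (hX : X ∈ V) (hA : A ∈ V) (hE : E ∈ V)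
    (k : ℕ) (hk : 2 ≤ k) :
    ∑ i ∈ Finset.range (k - 1), Matrix.trace (X * (A ^ i * E * A ^ (k - 1 - 1 - i))) = 0 := by
  refine sum_trace_mul_sandwich_eq_zero X A E (k - 1) fun z => ?_
  -- `tr(X (A + zE)^{k-1}) = 0` from `tr((A + zE + yX)^k) = 0` for all `y`
  have h1 := Summit.ValiantsHypothesis.ValiantsHypothesis.Theorems.GrenetZeon.HeavyTopBorderOrthogonality.trace_firstOrder_eq_zero
    (A + z • E) X (m := k) (by omega) fun y => hV _ (V.add_mem (V.add_mem hA (V.smul_mem z hE)) (V.smul_mem y hX)) k (by omega)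
  exact h1

end Summit.ValiantsHypothesis.ValiantsHypothesis.Theorems.GrenetZeon.HeavyTopTraceFirstOrder
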